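import Literature.AlgebraicGeometry.ModuliOfAbelianVarieties.SiegelHeckeQuotientTripleGlue
import Literature.AlgebraicGeometry.ModuliOfAbelianVarieties.SiegelHeckeLinkDegree
import Literature.AlgebraicGeometry.ModuliOfAbelianVarieties.SiegelModuliThickPoints
import Literature.AlgebraicGeometry.ModuliOfAbelianVarieties.SiegelHeckeQuotientClassMap
import Literature.AlgebraicGeometry.ModuliOfAbelianVarieties.SiegelFineModuliSchemeExists
import Literature.AlgebraicGeometry.AbelianSchemes.PolarizedAbelianSchemeWithLevelBaseChange
import Literature.AlgebraicGeometry.Resolution.SmoothStalksRegular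
import Literature.AlgebraicGeometry.HodgeTheory.HodgeGenericQbarDescentProofs
import Literature.AlgebraicGeometry.HodgeTheory.RelativeHyperplaneClassHodgeRiemann
import Literature.AlgebraicGeometry.Motives.UniversalHypersurfaceQuasiProjective
import Summits.HodgeConjecture.CorCM.HypDel.M1primeOfFU
import HarnessLib

/-!
# Quotient triples over the thick open piece — the PACKAGE ASSEMBLER of socket (QT), modulo the (ii)-chain package

Sub-problem `HodgeConjecture`, E-road v1.4a/v1.5 (`Cruxes/HDel/Lines/EquidimOfF.lean`): the one remaining sorry is
`stub_quotientTriples₈ : SocketQuotientTriples₈` (SOCKET (QT) text v1, B-plan1 (g15) c273ad9b = the binders of ★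
`EquidimHeckeQuotientFamily.socketQuotientMaps_of_quotientTriples` through `Nat.Coprime (N′/N) (∏ δᵢ)`, then its `hQ` body).
This file proves that text with ONE extra hypothesis after `hγ`: the (ii)-chain PACKAGE `hExt` for the universal family
pulled back to the piece (`A′ := ι′ℚ^* 𝓜′.univ`, base `S″`, `u := S″.hom`, `Y := Spec ℂ`) — verbatim the `hExt` telescope of
★ `exists_heckeQuotientTriple_of_ext` (glue ed.2), prefixed by `∀ d, N′ = N·d →`.  Inside: the link gives `δ′ = δ` and `N ∣ N′`
(so `N′ = N·d` syntactically after `obtain`), the open piece `S″` of the quasi-projective `𝓜′_ℂ` is reduced (smooth over `ℂ`,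
★ `Resolution.isReduced_of_smooth`), separated (★ `IsQuasiProjectiveOver.baseChangeHom/of_isOpenImmersion/isSeparated` over
(W1) ★ `W1.smooth_qproj_of_F`) and locally Noetherian; the structure morphisms of `A′` and `Â′` composed with `S″ → Spec ℂ` are
separated and locally of finite type (properness/smoothness of abelian schemes); then ★ `exists_heckeQuotientTriple_of_ext`
at `Ω := ℂ`.

References: [Milne2005ShimuraVarieties, §6 Thm. 6.11 pp. 74–75]; [MumfordAV1970, §7 Thm. 4 p. 72, §23 Thm. 2 p. 231];
[MumfordFogartyKirwan1994, Ch. 7 §3 Thm. 7.9 p. 139].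
-/

open CategoryTheory CategoryTheory.Limits AlgebraicGeometry Matrix
open scoped MonObj
open Literature.AlgebraicGeometry.Motives (SchemeOver ComplexPoints AlgPoints specOver baseChangeHomFst)
open Literature.AlgebraicGeometry.AbelianSchemes (PolarizedAbelianSchemeWithLevel AbelianSchemeOver)
open Literature.NumberTheory.Automorphic (siegelUpperHalfSpace)
open Literature.NumberTheory.Adeles
open Literature.AlgebraicGeometry.ModuliOfAbelianVarieties
open Literature.AlgebraicGeometry.HodgeTheory (IsQuasiProjectiveOver)
open Literature.AlgebraicGeometry (Motives.CartierDivisor Motives.AbelianVariety.Hom.toSchemeHom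
  AbelianSchemes.AbelianSchemeOver.isDominant_toSchemeHom_fibreHom AbelianSchemes.AbelianSchemeOver.fibreHom)

set_option linter.dupNamespace false  -- `Summit.HodgeConjecture.HodgeConjecture.…` is the cell's layout (D-0017)

namespace Summit.HodgeConjecture.HodgeConjecture.Theorems.EquidimHeckeQuotientTriplesOfPiece

open SiegelModuli

/-- **QUOTIENT TRIPLES OVER THE THICK OPEN PIECE, FROM THE (ii)-CHAIN PACKAGE** — the SOCKET (QT) text v1 (c273ad9b)
VERBATIM with ONE extra hypothesis `hExt` after `hγ` (the package of ★ `exists_heckeQuotientTriple_of_ext` for the piece,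
prefixed by `∀ d, N′ = N·d →`).  See the module docstring for the proof.
[cite: Milne2005ShimuraVarieties, §6 Thm. 6.11 pp. 74–75] [cite: MumfordAV1970, §7 Thm. 4 (p. 72) and §23 Thm. 2 (p. 231)]
[cite: MumfordFogartyKirwan1994, Ch. 7 §3 Theorem 7.9 (p. 139)] -/
theorem socketQuotientTriples_of_ext (hF : lan2013_siegelFineModuliScheme) (g N N' : ℕ) (δ δ' : Fin g → ℕ) (hg : 0 < g)
    (hδ : IsPolarizationType δ) (hN : 3 ≤ N) (hδ' : IsPolarizationType δ') (𝓜 : SiegelFineModuliScheme g N δ)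
    (𝓜' : SiegelFineModuliScheme g N' δ') (S'' : SchemeOver ℂ)
    (ι' : S'' ⟶ (Literature.AlgebraicGeometry.Motives.baseChange ℚ ℂ).obj 𝓜'.M) [IsOpenImmersion ι'.left]
    (d'' : ℕ) [SmoothOfRelativeDimension d'' S''.hom] (r' : gspFinAdelic δ') (hr' : r' ∈ principalLevelSubgroup δ' 1)
    (s' : ComplexPoints S'') (_hth : EquidimOfF.IsThickAtWith hδ' 𝓜' ι' d'' s' r')
    (x : ComplexPoints ((Literature.AlgebraicGeometry.Motives.baseChange ℚ ℂ).obj 𝓜.M))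
    (hlink : HeckeLinkedDeg 𝓜 𝓜' r' (AlgPoints.map (L := ℂ) ι' s') x (N' / N)) (_hodd : Odd (N' / N))
    (_hcop : Nat.Coprime (N' / N) (∏ i, δ i)) [NeZero N'] (ι'ℚ : S''.restrictScalars ℚ ⟶ 𝓜'.M)
    (hι : ι'.left ≫ baseChangeHomFst (algebraMap ℚ ℂ) 𝓜'.M = ι'ℚ.left)
    (γq : GL (Fin g ⊕ Fin g) ℚ) (r : gspFinAdelic δ) (hr : r ∈ principalLevelSubgroup δ 1)
    (hQA : QuotientAdapted δ δ' N N' r r' γq)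
    (hsim : (γq : Matrix (Fin g ⊕ Fin g) (Fin g ⊕ Fin g) ℚ)ᵀ * typeFormOver δ ℚ *
      (γq : Matrix (Fin g ⊕ Fin g) (Fin g ⊕ Fin g) ℚ) = (((N' / N : ℕ) : ℚ)) • typeFormOver δ' ℚ)
    (γm : Matrix (Fin g ⊕ Fin g) (Fin g ⊕ Fin g) ℤ)
    (hγ : ((γq : GL (Fin g ⊕ Fin g) ℚ) : Matrix (Fin g ⊕ Fin g) (Fin g ⊕ Fin g) ℚ) = γm.map (Int.cast : ℤ → ℚ))
    (hExt : ∀ (d : ℕ), N' = N * d →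
      ∀ [IsReduced S''.left] [IsLocallyNoetherian S''.left] [S''.left.IsSeparated]
        [IsSeparated ((PolarizedAbelianSchemeWithLevel.baseChange (S' := S''.left) 𝓜'.univ ι'ℚ.left).A.X.hom ≫ S''.hom)] [LocallyOfFiniteType ((PolarizedAbelianSchemeWithLevel.baseChange (S' := S''.left) 𝓜'.univ ι'ℚ.left).A.X.hom ≫ S''.hom)]
        [IsSeparated ((PolarizedAbelianSchemeWithLevel.baseChange (S' := S''.left) 𝓜'.univ ι'ℚ.left).D.hat.X.hom ≫ S''.hom)] [LocallyOfFiniteType ((PolarizedAbelianSchemeWithLevel.baseChange (S' := S''.left) 𝓜'.univ ι'ℚ.left).D.hat.X.hom ≫ S''.hom)]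
        [IsCommMonObj (PolarizedAbelianSchemeWithLevel.baseChange (S' := S''.left) 𝓜'.univ ι'ℚ.left).A.X]
        (K : Subgroup (PolarizedAbelianSchemeWithLevel.baseChange (S' := S''.left) 𝓜'.univ ι'ℚ.left).A.Sections) [Finite K]
        (hK : ∀ σ : K, (σ : (PolarizedAbelianSchemeWithLevel.baseChange (S' := S''.left) 𝓜'.univ ι'ℚ.left).A.Sections) ^ d = 1)
        (hfree : ∀ (Ω : Type) [Field Ω] [IsAlgClosed Ω] (x : Spec (.of Ω) ⟶ (PolarizedAbelianSchemeWithLevel.baseChange (S' := S''.left) 𝓜'.univ ι'ℚ.left).A.left) (σ : K), σ ≠ 1 →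
          x ≫ ((PolarizedAbelianSchemeWithLevel.baseChange (S' := S''.left) 𝓜'.univ ι'ℚ.left).A.translation (σ : (PolarizedAbelianSchemeWithLevel.baseChange (S' := S''.left) 𝓜'.univ ι'ℚ.left).A.Sections)).left ≠ x)
        (_ : ∀ σ : (PolarizedAbelianSchemeWithLevel.baseChange (S' := S''.left) 𝓜'.univ ι'ℚ.left).A.Sections, σ ∈ K ↔ ∃ c ∈ {c : Fin g ⊕ Fin g → ZMod N' |
            (γm.map (Int.castRingHom (ZMod N')) *
              Matrix.of (fun i j => integralAdeleResidue N'
                ⟨((r' : GL (Fin g ⊕ Fin g) finAdeleQ) : Matrix (Fin g ⊕ Fin g) (Fin g ⊕ Fin g) finAdeleQ) i j,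
                  entries_mem_integralAdeles_of_mem_principalLevelSubgroup_one hr' i j⟩)) *ᵥ c = 0},
            (PolarizedAbelianSchemeWithLevel.baseChange (S' := S''.left) 𝓜'.univ ι'ℚ.left).level.section_ c = σ),
        ∃ (hcov : ∀ x : (PolarizedAbelianSchemeWithLevel.baseChange (S' := S''.left) 𝓜'.univ ι'ℚ.left).A.left, ∃ O : ((PolarizedAbelianSchemeWithLevel.baseChange (S' := S''.left) 𝓜'.univ ι'ℚ.left).A.translationActionOver S''.hom K).StableAffineOpens, x ∈ O.1)
          (hG : ∃ _ : GrpObj ((PolarizedAbelianSchemeWithLevel.baseChange (S' := S''.left) 𝓜'.univ ι'ℚ.left).A.quotientOver S''.hom K), IsMonHom ((PolarizedAbelianSchemeWithLevel.baseChange (S' := S''.left) 𝓜'.univ ι'ℚ.left).A.quotientMk S''.hom K hcov))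
          (hsm : Smooth ((PolarizedAbelianSchemeWithLevel.baseChange (S' := S''.left) 𝓜'.univ ι'ℚ.left).A.quotientOver S''.hom K).hom)
          (hgc : GeometricallyConnected ((PolarizedAbelianSchemeWithLevel.baseChange (S' := S''.left) 𝓜'.univ ι'ℚ.left).A.quotientOver S''.hom K).hom)
          (K' : Subgroup (PolarizedAbelianSchemeWithLevel.baseChange (S' := S''.left) 𝓜'.univ ι'ℚ.left).D.hat.Sections) (_ : Finite K')
          (hcov' : ∀ x : (PolarizedAbelianSchemeWithLevel.baseChange (S' := S''.left) 𝓜'.univ ι'ℚ.left).D.hat.left, ∃ O : ((PolarizedAbelianSchemeWithLevel.baseChange (S' := S''.left) 𝓜'.univ ι'ℚ.left).D.hat.translationActionOver S''.hom K').StableAffineOpens, x ∈ O.1)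
          (hG' : ∃ _ : GrpObj ((PolarizedAbelianSchemeWithLevel.baseChange (S' := S''.left) 𝓜'.univ ι'ℚ.left).D.hat.quotientOver S''.hom K'), IsMonHom ((PolarizedAbelianSchemeWithLevel.baseChange (S' := S''.left) 𝓜'.univ ι'ℚ.left).D.hat.quotientMk S''.hom K' hcov'))
          (hsm' : Smooth ((PolarizedAbelianSchemeWithLevel.baseChange (S' := S''.left) 𝓜'.univ ι'ℚ.left).D.hat.quotientOver S''.hom K').hom)
          (hgc' : GeometricallyConnected ((PolarizedAbelianSchemeWithLevel.baseChange (S' := S''.left) 𝓜'.univ ι'ℚ.left).D.hat.quotientOver S''.hom K').hom)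
          (hfree' : ∀ (Ω : Type) [Field Ω] [IsAlgClosed Ω] (x : Spec (.of Ω) ⟶ (PolarizedAbelianSchemeWithLevel.baseChange (S' := S''.left) 𝓜'.univ ι'ℚ.left).D.hat.left) (σ : K'), σ ≠ 1 →
            x ≫ ((PolarizedAbelianSchemeWithLevel.baseChange (S' := S''.left) 𝓜'.univ ι'ℚ.left).D.hat.translation (σ : (PolarizedAbelianSchemeWithLevel.baseChange (S' := S''.left) 𝓜'.univ ι'ℚ.left).D.hat.Sections)).left ≠ x)
          (Φ : (AbelianSchemeOver.prodTranslationActionOver ((PolarizedAbelianSchemeWithLevel.baseChange (S' := S''.left) 𝓜'.univ ι'ℚ.left).A.quotientBy S''.hom K hcov hG hsm hgc) (PolarizedAbelianSchemeWithLevel.baseChange (S' := S''.left) 𝓜'.univ ι'ℚ.left).D.hat S''.hom K' hcov').EquivariantStructure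
            ((PolarizedAbelianSchemeWithLevel.baseChange (S' := S''.left) 𝓜'.univ ι'ℚ.left).A.poincarePullback S''.hom K hK hcov hG hsm hgc (PolarizedAbelianSchemeWithLevel.baseChange (S' := S''.left) 𝓜'.univ ι'ℚ.left).D hfree))
          (h4 : ∀ {T : Scheme} (f : T ⟶ S''.left) (ℒ : ((PolarizedAbelianSchemeWithLevel.baseChange (S' := S''.left) 𝓜'.univ ι'ℚ.left).A.quotientBy S''.hom K hcov hG hsm hgc).RigidifiedLineBundle f),
            ℒ.FibrewisePicZero →
            ∃! g : {g : T ⟶ ((PolarizedAbelianSchemeWithLevel.baseChange (S' := S''.left) 𝓜'.univ ι'ℚ.left).D.hat.quotientBy S''.hom K' hcov' hG' hsm' hgc').X.left //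
                g ≫ ((PolarizedAbelianSchemeWithLevel.baseChange (S' := S''.left) 𝓜'.univ ι'ℚ.left).D.hat.quotientBy S''.hom K' hcov' hG' hsm' hgc').X.hom = f},
              Nonempty ((Scheme.Modules.pullback (((PolarizedAbelianSchemeWithLevel.baseChange (S' := S''.left) 𝓜'.univ ι'ℚ.left).A.quotientBy S''.hom K hcov hG hsm hgc).baseChangeToProd
                ((PolarizedAbelianSchemeWithLevel.baseChange (S' := S''.left) 𝓜'.univ ι'ℚ.left).D.hat.quotientBy S''.hom K' hcov' hG' hsm' hgc') f g.1 g.2)).obj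
                  ((PolarizedAbelianSchemeWithLevel.baseChange (S' := S''.left) 𝓜'.univ ι'ℚ.left).A.poincareQuotRigid S''.hom K hK hcov hG hsm hgc (PolarizedAbelianSchemeWithLevel.baseChange (S' := S''.left) 𝓜'.univ ι'ℚ.left).D hfree K' hcov' hG' hsm' hgc' Φ) ≅ ℒ.L))
          (hlam : ∀ σ : K, (PolarizedAbelianSchemeWithLevel.baseChange (S' := S''.left) 𝓜'.univ ι'ℚ.left).A.translation (σ : (PolarizedAbelianSchemeWithLevel.baseChange (S' := S''.left) 𝓜'.univ ι'ℚ.left).A.Sections) ≫ (PolarizedAbelianSchemeWithLevel.baseChange (S' := S''.left) 𝓜'.univ ι'ℚ.left).pol.lam ≫ (PolarizedAbelianSchemeWithLevel.baseChange (S' := S''.left) 𝓜'.univ ι'ℚ.left).D.hat.quotientMk S''.hom K' hcov' =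
            (PolarizedAbelianSchemeWithLevel.baseChange (S' := S''.left) 𝓜'.univ ι'ℚ.left).pol.lam ≫ (PolarizedAbelianSchemeWithLevel.baseChange (S' := S''.left) 𝓜'.univ ι'ℚ.left).D.hat.quotientMk S''.hom K' hcov')
          (polB : ((PolarizedAbelianSchemeWithLevel.baseChange (S' := S''.left) 𝓜'.univ ι'ℚ.left).A.quotientBy S''.hom K hcov hG hsm hgc).Polarization
            ((PolarizedAbelianSchemeWithLevel.baseChange (S' := S''.left) 𝓜'.univ ι'ℚ.left).A.dualPairOfQuotientRigidified S''.hom K hK hcov hG hsm hgc (PolarizedAbelianSchemeWithLevel.baseChange (S' := S''.left) 𝓜'.univ ι'ℚ.left).D hfree K' hcov' hG' hsm' hgc' hfree' Φ h4))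
          (_ : polB.lam = (PolarizedAbelianSchemeWithLevel.baseChange (S' := S''.left) 𝓜'.univ ι'ℚ.left).A.polarizationDesc S''.hom K hcov (PolarizedAbelianSchemeWithLevel.baseChange (S' := S''.left) 𝓜'.univ ι'ℚ.left).D.hat K' hcov' (PolarizedAbelianSchemeWithLevel.baseChange (S' := S''.left) 𝓜'.univ ι'ℚ.left).pol.lam hlam),
          polB.HasType δ) :
    ∃ (Q : PolarizedAbelianSchemeWithLevel g N δ S''.left)
      (ψ : (PolarizedAbelianSchemeWithLevel.baseChange (S' := S''.left) 𝓜'.univ ι'ℚ.left).A.X ⟶ Q.A.X) (_ : IsMonHom ψ)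
      (_ : Surjective ψ.left) (_ : LocallyOfFiniteType ψ.left),
      (∀ i, Q.level.σ i =
        ((PolarizedAbelianSchemeWithLevel.baseChange (S' := S''.left) 𝓜'.univ ι'ℚ.left).level.σ i ^ (N' / N)) ≫ ψ) ∧
      (∀ (s : ComplexPoints S'')
        (x : (PolarizedAbelianSchemeWithLevel.baseChange (S' := S''.left) 𝓜'.univ ι'ℚ.left).A.FibrePoints s.left),
        x ≫ ψ = 1 ↔ ∃ c ∈ {c : Fin g ⊕ Fin g → ZMod N' |
            (γm.map (Int.castRingHom (ZMod N')) *
              Matrix.of (fun i j => integralAdeleResidue N'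
                ⟨((r' : GL (Fin g ⊕ Fin g) finAdeleQ) : Matrix (Fin g ⊕ Fin g) (Fin g ⊕ Fin g) finAdeleQ) i j,
                  entries_mem_integralAdeles_of_mem_principalLevelSubgroup_one hr' i j⟩)) *ᵥ c = 0},
          x = (PolarizedAbelianSchemeWithLevel.baseChange (S' := S''.left) 𝓜'.univ ι'ℚ.left).A.restrict s.left
            ((PolarizedAbelianSchemeWithLevel.baseChange (S' := S''.left) 𝓜'.univ ι'ℚ.left).level.section_ c)) ∧
      (∀ (t : Spec (.of ℂ) ⟶ S''.left) (Θ₀ : Motives.CartierDivisor (Q.A.fibre t).toAbelianVariety.X.left),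
        haveI := AbelianSchemes.AbelianSchemeOver.isDominant_toSchemeHom_fibreHom ψ t
        Q.A.IsLambdaOfAt t Q.D Q.pol.lam Θ₀ →
          (PolarizedAbelianSchemeWithLevel.baseChange (S' := S''.left) 𝓜'.univ ι'ℚ.left).A.IsLambdaOfAt t
            (PolarizedAbelianSchemeWithLevel.baseChange (S' := S''.left) 𝓜'.univ ι'ℚ.left).D
            ((PolarizedAbelianSchemeWithLevel.baseChange (S' := S''.left) 𝓜'.univ ι'ℚ.left).pol.lam ^ (N' / N))
            (Θ₀.pullback (Motives.AbelianVariety.Hom.toSchemeHom (AbelianSchemes.AbelianSchemeOver.fibreHom ψ t))))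
  := by
  classical
  -- ### the link: `δ′ = δ`, `N ∣ N′` (so `N′ = N·d`)
  obtain ⟨-, -, -, -, γ₀, -, r₀, -, hδδ, hQA₀, -, -⟩ := id hlink
  subst hδδ
  obtain ⟨d, rfl⟩ := hQA.1
  have hN0 : N ≠ 0 := by omega
  have hd0 : d ≠ 0 := by rintro rfl; exact (NeZero.ne (N * 0)) (Nat.mul_zero N)
  have hdd : N * d / N = d := Nat.mul_div_cancel_left d (Nat.pos_of_ne_zero hN0)
  rw [hdd] at hsim
  simp only [hdd]
  have hN' : 3 ≤ N * d := le_trans hN (Nat.le_mul_of_pos_right N (Nat.pos_of_ne_zero hd0))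
  -- ### instances of the open piece `S″` of the quasi-projective `𝓜′_ℂ`
  haveI : IsLocallyNoetherian (specOver ℚ ℂ).left := inferInstanceAs (IsLocallyNoetherian (Spec (CommRingCat.of ℂ)))
  haveI : Smooth S''.hom := SmoothOfRelativeDimension.smooth d'' _
  haveI : LocallyOfFiniteType S''.hom := inferInstance
  haveI : IsLocallyNoetherian S''.left := LocallyOfFiniteType.isLocallyNoetherian S''.hom
  haveI : IsReduced S''.left := Literature.AlgebraicGeometry.Resolution.isReduced_of_smooth S''.hom
  obtain ⟨-, hMq, -⟩ := W1.smooth_qproj_of_F hF hg hδ hN' 𝓜'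
  have hMqℂ : IsQuasiProjectiveOver ((Literature.AlgebraicGeometry.Motives.baseChange ℚ ℂ).obj 𝓜'.M) := by
    rw [← Literature.AlgebraicGeometry.Motives.baseChangeHom_algebraMap]
    exact hMq.baseChangeHom (algebraMap ℚ ℂ)
  have hSq : IsQuasiProjectiveOver S'' := IsQuasiProjectiveOver.of_isOpenImmersion ι' hMqℂ
  haveI : IsSeparated S''.hom := hSq.isSeparated
  haveI : S''.left.IsSeparated := ⟨by rw [← terminal.comp_from S''.hom]; infer_instance⟩
  set P' := PolarizedAbelianSchemeWithLevel.baseChange (S' := S''.left) 𝓜'.univ ι'ℚ.left with hP'def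
  haveI := P'.A.isProper
  haveI := P'.A.isSmooth
  haveI := P'.D.hat.isProper
  haveI := P'.D.hat.isSmooth
  haveI : IsSeparated (P'.A.X.hom ≫ S''.hom) := inferInstance
  haveI : LocallyOfFiniteType (P'.A.X.hom ≫ S''.hom) := inferInstance
  haveI : IsSeparated (P'.D.hat.X.hom ≫ S''.hom) := inferInstance
  haveI : LocallyOfFiniteType (P'.D.hat.X.hom ≫ S''.hom) := inferInstance
  haveI : IsCommMonObj P'.A.X := P'.A.isCommMonObj_of_isReduced_base
  -- ### the glue at `Ω := ℂ`
  obtain ⟨Q, ψ, hψ, hsurj, hlft, hlev, hker, hΛ⟩ :=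
    exists_heckeQuotientTriple_of_ext hg hδ hN0 hd0 S''.hom P' hr hr' hQA hsim γm hγ (hExt d rfl)
  exact ⟨Q, ψ, hψ, hsurj, hlft, hlev, fun s x => hker ℂ s.left x, fun t Θ₀ => hΛ ℂ t Θ₀⟩

end Summit.HodgeConjecture.HodgeConjecture.Theorems.EquidimHeckeQuotientTriplesOfPiece
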